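import Summits.Langlands.Langlands.Theses.QuadraticWindow

/-!
# Birth skeleton (BC3) of the D5 piece `IrregularSatakeExistence` of the split of `BeyondTheWindow` (stmt-Langlands-3202)

≥ 2 NAMED stubs `stub_*` (sorry) and the kernel-checked composition `IrregularSatakeExistence_of : stubs → IrregularSatakeExistence`
concluding the piece's statement VERBATIM (the piece is not yet a route decl: it is written out).  To be
published as `Lines/birth.lean` of the child item once the split of `BeyondTheWindow` lands.
-/

set_option linter.dupNamespace false
set_option linter.unusedVariables false

noncomputable section

namespace Summit.Langlands.Langlands.Cruxes.BeyondTheWindow.Birth.IrregularSatakeExistence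

open scoped Classical
open Summit.Langlands.Langlands.Theses.QuadraticWindow
open Literature.NumberTheory.Automorphic Literature.NumberTheory.GaloisRepresentations
open NumberField IsDedekindDomain Filter Polynomial

/-- **stub 1 — irregular existence over totally real or CM fields** (the declared open core of
LiftDescend.AutToGalCM, at Satake level: weight-one type in rank `n`, base changes of algebraic Maass forms;
known: `n = 1` by CFT/Weil — tree `theoremA_existence_rank_one` —, `GL_2` weight one by Deligne–Serre, partial
weight one over totally real fields). [cite: DeligneSerre1974] -/
theorem stub_irregularOverCMOrTotallyReal : ∀ (F : Type) [Field F] [NumberField F], (NumberField.IsTotallyReal F ∨ NumberField.IsCMField F) → ∀ (n : ℕ), 0 < n → ∀ (hcpt : Literature.NumberTheory.Automorphic.isCompact_glFiniteIntegralLevel n F) (π : Literature.NumberTheory.Automorphic.CuspidalAutomorphicRepData n F hcpt), π.1.IsLAlgebraic → (∀ T : Literature.NumberTheory.Automorphic.InfinityType F n, π.1.HasInfinityType T → ¬ T.IsRegular) → ∀ (ℓ : ℕ) [Fact ℓ.Prime] (ι : PadicAlgCl ℓ ≃+* ℂ), ∃ ρ : Literature.NumberTheory.GaloisRepresentations.FramedGaloisRep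 F (PadicAlgCl ℓ) n, ρ.toGaloisRep.IsSemisimple ∧ ∀ᶠ v in Filter.cofinite, SatakeFrobCompatibleAt ι π.1 ρ v := by
  sorry

/-- **stub 2 — irregular existence over fields of mixed signature** (no engine at all; Calegari 2021 §12).
[cite: Calegari2023, §12] -/
theorem stub_irregularOverMixedSignature : ∀ (F : Type) [Field F] [NumberField F], ¬ (NumberField.IsTotallyReal F ∨ NumberField.IsCMField F) → ∀ (n : ℕ), 0 < n → ∀ (hcpt : Literature.NumberTheory.Automorphic.isCompact_glFiniteIntegralLevel n F) (π : Literature.NumberTheory.Automorphic.CuspidalAutomorphicRepData n F hcpt), π.1.IsLAlgebraic → (∀ T : Literature.NumberTheory.Automorphic.InfinityType F n, π.1.HasInfinityType T → ¬ T.IsRegular) → ∀ (ℓ : ℕ) [Fact ℓ.Prime] (ι : PadicAlgCl ℓ ≃+* ℂ), ∃ ρ : Literature.NumberTheory.GaloisRepresentations.FramedGaloisRep F (PadicAlgCl ℓ) n, ρ.toGaloisRep.IsSemisimple ∧ ∀ᶠ v in Filter.cofinite, SatakeFrobCompatibleAt ι π.1 ρ v := by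
  sorry

/-- **Composition (real proof):** partition by the field class. [folklore] -/
theorem IrregularSatakeExistence_of
    (h₁ : ∀ (F : Type) [Field F] [NumberField F], (NumberField.IsTotallyReal F ∨ NumberField.IsCMField F) → ∀ (n : ℕ), 0 < n → ∀ (hcpt : Literature.NumberTheory.Automorphic.isCompact_glFiniteIntegralLevel n F) (π : Literature.NumberTheory.Automorphic.CuspidalAutomorphicRepData n F hcpt), π.1.IsLAlgebraic → (∀ T : Literature.NumberTheory.Automorphic.InfinityType F n, π.1.HasInfinityType T → ¬ T.IsRegular) → ∀ (ℓ : ℕ) [Fact ℓ.Prime] (ι : PadicAlgCl ℓ ≃+* ℂ), ∃ ρ : Literature.NumberTheory.GaloisRepresentations.FramedGaloisRep F (PadicAlgCl ℓ) n, ρ.toGaloisRep.IsSemisimple ∧ ∀ᶠ v in Filter.cofinite, SatakeFrobCompatibleAt ι π.1 ρ v)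
    (h₂ : ∀ (F : Type) [Field F] [NumberField F], ¬ (NumberField.IsTotallyReal F ∨ NumberField.IsCMField F) → ∀ (n : ℕ), 0 < n → ∀ (hcpt : Literature.NumberTheory.Automorphic.isCompact_glFiniteIntegralLevel n F) (π : Literature.NumberTheory.Automorphic.CuspidalAutomorphicRepData n F hcpt), π.1.IsLAlgebraic → (∀ T : Literature.NumberTheory.Automorphic.InfinityType F n, π.1.HasInfinityType T → ¬ T.IsRegular) → ∀ (ℓ : ℕ) [Fact ℓ.Prime] (ι : PadicAlgCl ℓ ≃+* ℂ), ∃ ρ : Literature.NumberTheory.GaloisRepresentations.FramedGaloisRep F (PadicAlgCl ℓ) n, ρ.toGaloisRep.IsSemisimple ∧ ∀ᶠ v in Filter.cofinite, SatakeFrobCompatibleAt ι π.1 ρ v) :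
    ∀ (F : Type) [Field F] [NumberField F] (n : ℕ), 0 < n → ∀ (hcpt : Literature.NumberTheory.Automorphic.isCompact_glFiniteIntegralLevel n F) (π : Literature.NumberTheory.Automorphic.CuspidalAutomorphicRepData n F hcpt), π.1.IsLAlgebraic → (∀ T : Literature.NumberTheory.Automorphic.InfinityType F n, π.1.HasInfinityType T → ¬ T.IsRegular) → ∀ (ℓ : ℕ) [Fact ℓ.Prime] (ι : PadicAlgCl ℓ ≃+* ℂ), ∃ ρ : Literature.NumberTheory.GaloisRepresentations.FramedGaloisRep F (PadicAlgCl ℓ) n, ρ.toGaloisRep.IsSemisimple ∧ ∀ᶠ v in Filter.cofinite, SatakeFrobCompatibleAt ι π.1 ρ v := by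
  intro F _ _ n hn hcpt π hL hirr ℓ _ ι
  by_cases hF : IsTotallyReal F ∨ IsCMField F
  · exact h₁ F hF n hn hcpt π hL hirr ℓ ι
  · exact h₂ F hF n hn hcpt π hL hirr ℓ ι

end Summit.Langlands.Langlands.Cruxes.BeyondTheWindow.Birth.IrregularSatakeExistence

end
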